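import Summits.ResolutionOfSingularities.ResolutionOfSingularities.Theorems.EquisingularLiftEquisingularLiftNatUncentredPairLemmas
import Summits.ResolutionOfSingularities.ResolutionOfSingularities.Theorems.EquisingularLiftEquisingularLiftNatDeltaConeLiftPlane
import HarnessLib

/-!
# [OURS · L1 W4.5(b) · EL♮(3)] HSUB(ReachTC⁺) brick `inv_base`, part 1b: THE CONE GERM OF THE UNCENTRED MEMBER — for EVERY cone ideal
# sheaf `K₀` with the prescribed germ, the in-carrier pair `(E, St_{τ₁} K₀)` has exact special fibre, is flat, regular, of codimension 2

Crux chain w45b (cell `res-hironaka`, slot W4.5(b)), working crux **EL♮** = stmt-ResolutionOfSingularities-20038, child **EL♮(3)** =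
stmt-ResolutionOfSingularities-20148, route EquisingularLift, line `sections`, registered stub `stub_elnat_tcPlusPointResolution`;
assembly HSUB(ReachTC⁺)₃ of res-L1-w45b-stub-1 (driver `hsub_reachTCPlus_of_invariant` p526242, INV DEFS v3 1e1671195d5398d0; brick
`inv_base` dealt to res-type-100 2026-08-27T11:31:42Z). HONEST FRAMING: OURS; NOT a statement of any manuscript; AI-written, weaker than
expert review. No `sorry`; standard axioms. `--supports stmt-ResolutionOfSingularities-20148 --as helper`. DEF-FREE.

WHAT.
* `ringKrullDim_quotient_carrierDelta_add_two` — Member clause (v), codimension part: at a point `x'` of the Δ-centre `C = St_τ(K) ⊔ E`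
  over the cone vertex, `dim 𝒪_{X',x'}/C_{x'} + 2 = dim 𝒪_{X',x'}` (the exceptional generator is a non-zero-divisor in `𝔪_{x'}`, and the
  strict transform `Φ(c/c_j)` of the cone is a non-zero-divisor of the DOMAIN `𝒪_{X',x'}/E_{x'}` — regular by part 1a — because
  `Φ̄_j ≠ 0` in `R[I/c_j]/(c_j) ≅ (R/(c))[T]`; twice Mathlib's `ringKrullDim_quotient_span_singleton_succ_eq_ringKrullDim_of_mem_nonZeroDivisors`).
* **`exists_coneGerm_of_admTC`** — in the binders of HΔTC (`exists_carrierDelta_of_admTC`, res-L1-w45b-lead-1 p527936 / res-type-100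
  p524961, any `n`): the carrier `E = (ker s)·𝒪_{X₁}` is a regular scheme with principal stalks, and there is a NON-ZERO germ
  `f ∈ 𝒪_{X',j x}` (the `O`-cone `Φ₀(c)` of a Δ-regular lift of the square-free reduced tangent cone) such that for EVERY ideal sheaf
  `K₀` on `X'` with `K₀_{j x} = (f)`, the pair `(E, K := St_{τ₁} K₀)` satisfies: (i) `(E ⊔ K)·𝒪_{F₂} = 𝓘(Z)` for the trace
  `Z = υ⁻¹{x} ∩ closure υ⁻¹(W ∖ {x})`; (ii) `V(E ⊔ K) → Spec O` flat; (iii′) `K_z` principal at the points of `V(E ⊔ K)` over the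
  closed point; (iv) `supp (E ⊔ K) ⊆ supp E`; (v) `𝒪_{X₁,z}/(E ⊔ K)_z` regular at every point of `V(E ⊔ K)`, of codimension `2` at its
  special points; `V(E ⊔ K)` regular. The freedom in `K₀` lets part 1d take the prescribed-germ CARTIER DIVISOR, stalkwise principal
  on all of `X'` (Member clause (iii) verbatim via res-D-pv-032's `isPrincipal_stalkIdeal_strictTransformIdeal`, p529806).
  PROOF = the HΔTC assembly verbatim feeding part 1a's `carrierDelta_clauses_of_stalk` and res-D-pv-029's (v); the lift is
  res-type-032's PLANE T-ΔLIFT at `n = 3` (no finiteness input) or the general one with stub-2's finiteness transport.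
-/

set_option linter.dupNamespace false -- mandated namespace `Summit.<Summit>.<Problem>` of this single-conjunct summit
set_option linter.overlappingInstances false -- the binders carry `[IsDomain O] [IsDiscreteValuationRing O]`

noncomputable section

open CategoryTheory CategoryTheory.Limits AlgebraicGeometry TopologicalSpace IsLocalRing
open Literature.AlgebraicGeometry.Resolution
open AlgebraicGeometry.Scheme.IdealSheafData
open Summit.ResolutionOfSingularities.ResolutionOfSingularities.Cruxes.EquisingularLift.StrataSplit

namespace Summit.ResolutionOfSingularities.ResolutionOfSingularities.Cruxes.EquisingularLiftNat.Sections

universe u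

/-! ## Codimension two -/

section Codim

variable {X X' : Scheme.{u}} {τ : X' ⟶ X} {J : X.IdealSheafData}

/-- In a local ring `S` with an ideal `E` such that `S ⧸ E` is a local ring, an element of `𝔪_S` maps into `𝔪_{S/E}` (the quotient
map is a local homomorphism, Mathlib `IsLocalHom.of_surjective`). [folklore] -/
theorem mk_mem_maximalIdeal_of_mem {S : Type u} [CommRing S] [IsLocalRing S] (E : Ideal S) [IsLocalRing (S ⧸ E)] {b : S}
    (hb : b ∈ maximalIdeal S) : Ideal.Quotient.mk E b ∈ maximalIdeal (S ⧸ E) := by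
  haveI := IsLocalHom.of_surjective (Ideal.Quotient.mk E) Ideal.Quotient.mk_surjective
  exact map_nonunit (Ideal.Quotient.mk E) b hb

set_option maxHeartbeats 400000 in -- the chart algebra `blowupAlgebra` is a subalgebra of a localisation: slow instance unification (cf. p509910)
/-- **Member clause (v), codimension: `dim 𝒪_{X',x'}/C_{x'} + 2 = dim 𝒪_{X',x'}` at the points of the Δ-centre over the vertex.**
Setting of F2 (`exists_stalk_strictTransformIdeal_sup_comap`): `τ` a blow-up along `J`, `X'` locally Noetherian, `τ x' = p ∈ supp J`, `J_p = (c)`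
with `c` quasi-regular, `R/(c)` a regular domain (`R = 𝒪_{X,p}`), `K_p = (Φ(c))` for a form `Φ` with `Φ mod (c) ≠ 0`, `x' ∈ V(C)`,
`C = St_τ(K) ⊔ E`. The exceptional generator `t` is a non-zero-divisor in `𝔪_{x'}` (`dim 𝒪/E + 1 = dim 𝒪`), and modulo `E` the cone
`Φ(c/c_j)` is a non-zero non-unit of the regular local DOMAIN `𝒪_{x'}/E_{x'}` (part 1a; `Φ(c/c_j) ∉ (c_j/1)·R[I/c_j]_𝔔` because
`(c_j/1)` is prime with quotient `(R/(c))[T]` and `Φ̄_j ≠ 0`, res-type-100 `mem_span_algebraMap_of_coneTransform_mul_mem` p508912), so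
`dim 𝒪/C + 1 = dim 𝒪/E`. [cite: StacksProject, Tag 00KW] -/
theorem ringKrullDim_quotient_carrierDelta_add_two [IsLocallyNoetherian X'] (hτ : IsBlowup τ J)
    (K : X.IdealSheafData) (x' : X') (p : X) (hp : τ x' = p) (hpJ : p ∈ (J.support : Set X)) {r : ℕ}
    (c : Fin r → X.presheaf.stalk p) (hcJ : Ideal.span (Set.range c) = stalkIdeal J p)
    (hc : IsQuasiRegular c) [IsDomain (X.presheaf.stalk p ⧸ Ideal.span (Set.range c))]
    [IsRegularRing (X.presheaf.stalk p ⧸ Ideal.span (Set.range c))]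
    {d : ℕ} (Φ : MvPolynomial (Fin r) (X.presheaf.stalk p)) (hΦd : Φ.IsHomogeneous d)
    (hΦ : MvPolynomial.map (Ideal.Quotient.mk (Ideal.span (Set.range c))) Φ ≠ 0)
    (hK : stalkIdeal K p = Ideal.span {MvPolynomial.eval c Φ})
    (hx' : x' ∈ (strictTransformIdeal τ J K ⊔ J.comap τ).support) :
    ringKrullDim (X'.presheaf.stalk x' ⧸ stalkIdeal (strictTransformIdeal τ J K ⊔ J.comap τ) x') + 2 =
      ringKrullDim (X'.presheaf.stalk x') := by
  subst hp
  obtain ⟨j, 𝔔, χ, e, hχ, he, h𝔔, hE, hSt, hC, hiff⟩ :=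
    exists_stalk_strictTransformIdeal_sup_comap hτ K x' hpJ c hcJ hc Φ hΦd hΦ hK
  letI := χ.toAlgebra
  haveI : IsLocalization.AtPrime (X'.presheaf.stalk x') 𝔔.asIdeal := isLocalization_stalk_of_ringEquiv 𝔔 x' χ e he
  -- the quotient by the exceptional ideal is a regular local ring (part 1a), hence a local Noetherian domain
  haveI hEreg : IsRegularLocalRing (X'.presheaf.stalk x' ⧸ stalkIdeal (J.comap τ) x') :=
    isRegularLocalRing_stalk_quotient_exceptional hτ x' _ rfl hpJ c hcJ hc
  have hx'E : x' ∈ (J.comap τ).support := by rw [Scheme.IdealSheafData.support_sup] at hx'; exact hx'.2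
  have hb𝔪 : χ (MvPolynomial.aeval (blowupAlgebra.frac c j) Φ) ∈ maximalIdeal (X'.presheaf.stalk x') := by
    have h := (mem_support_iff_stalkIdeal_le _ x').mp hx'
    rw [hC] at h
    exact h (Ideal.mem_sup_left (Ideal.mem_span_singleton_self _))
  -- step 1: `dim 𝒪/E + 1 = dim 𝒪`
  obtain ⟨t, ht0, ht⟩ := hτ.isEffectiveCartier.exists_stalkIdeal_eq_span x'
  have ht𝔪 : t ∈ maximalIdeal (X'.presheaf.stalk x') := by
    have h := (mem_support_iff_stalkIdeal_le _ x').mp hx'E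
    rw [ht] at h
    exact h (Ideal.mem_span_singleton_self t)
  have h1 : ringKrullDim (X'.presheaf.stalk x' ⧸ stalkIdeal (J.comap τ) x') + 1 = ringKrullDim (X'.presheaf.stalk x') := by
    rw [ht]; exact ringKrullDim_quotient_span_singleton_succ_eq_ringKrullDim_of_mem_nonZeroDivisors ht0 ht𝔪
  -- step 2: modulo `E`, the cone `Φ(c/c_j)` is non-zero
  have hb0 : Ideal.Quotient.mk (stalkIdeal (J.comap τ) x') (χ (MvPolynomial.aeval (blowupAlgebra.frac c j) Φ)) ≠ 0 := by
    intro h0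
    rw [Ideal.Quotient.eq_zero_iff_mem, hE] at h0
    have h0' : χ (MvPolynomial.aeval (blowupAlgebra.frac c j) Φ) ∈
        (Ideal.span {algebraMap _ (blowupAlgebra (Ideal.span (Set.range c)) (c j)) (c j)}).map
          (algebraMap (blowupAlgebra (Ideal.span (Set.range c)) (c j)) (X'.presheaf.stalk x')) := by
      rw [Ideal.map_span, Set.image_singleton]; exact h0
    obtain ⟨⟨⟨i, hi⟩, ⟨m, hm⟩⟩, him⟩ := (IsLocalization.mem_map_algebraMap_iff 𝔔.asIdeal.primeCompl _).mp h0'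
    change χ _ * χ m = χ i at him
    rw [← map_mul, ← sub_eq_zero, ← map_sub] at him
    change algebraMap _ (X'.presheaf.stalk x') _ = 0 at him
    obtain ⟨⟨m', hm'⟩, hm'0⟩ := (IsLocalization.map_eq_zero_iff 𝔔.asIdeal.primeCompl _ _).mp him
    change m' * _ = 0 at hm'0
    have hΦj : MvPolynomial.map (Ideal.Quotient.mk (Ideal.span (Set.range c))) (dehomogenize j Φ) ≠ 0 := by
      rw [map_dehomogenize]
      exact dehomogenize_ne_zero_of_isHomogeneous j (hΦd.map _) hΦ
    -- `Φ(e) · (m m') = i m' ∈ (c_j/1)`, so `m m' ∈ (c_j/1) ⊆ 𝔔`: contradiction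
    have hmem : MvPolynomial.aeval (blowupAlgebra.frac c j) Φ * (m * m') ∈
        Ideal.span {algebraMap _ (blowupAlgebra (Ideal.span (Set.range c)) (c j)) (c j)} := by
      have heq : MvPolynomial.aeval (blowupAlgebra.frac c j) Φ * (m * m') = i * m' := by
        linear_combination hm'0
      rw [heq]
      exact Ideal.mul_mem_right _ _ hi
    have hmm : m * m' ∈ 𝔔.asIdeal := by
      have h := mem_span_algebraMap_of_coneTransform_mul_mem c j hc hΦj _ hmem
      have ht𝔔 : Ideal.span {algebraMap _ (blowupAlgebra (Ideal.span (Set.range c)) (c j)) (c j)} ≤ 𝔔.asIdeal := by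
        rw [Ideal.span_singleton_le_iff_mem, ← Ideal.mem_comap, h𝔔]
        have h' := (mem_support_iff_stalkIdeal_le J (τ x')).mp hpJ
        rw [← hcJ] at h'
        exact h' (Ideal.subset_span (Set.mem_range_self j))
      exact ht𝔔 h
    rcases 𝔔.isPrime.mem_or_mem hmm with h | h
    · exact hm h
    · exact hm' h
  haveI := isDomain_of_isRegularLocalRing (X'.presheaf.stalk x' ⧸ stalkIdeal (J.comap τ) x')
  have hbnz : Ideal.Quotient.mk (stalkIdeal (J.comap τ) x') (χ (MvPolynomial.aeval (blowupAlgebra.frac c j) Φ)) ∈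
      nonZeroDivisors (X'.presheaf.stalk x' ⧸ stalkIdeal (J.comap τ) x') :=
    mem_nonZeroDivisors_of_ne_zero hb0
  have hb𝔪' := mk_mem_maximalIdeal_of_mem (stalkIdeal (J.comap τ) x') hb𝔪
  have h2 := ringKrullDim_quotient_span_singleton_succ_eq_ringKrullDim_of_mem_nonZeroDivisors hbnz hb𝔪'
  -- `𝒪/C ≅ (𝒪/E)/(Φ(c/c_j))`
  have hCE : stalkIdeal (strictTransformIdeal τ J K ⊔ J.comap τ) x' =
      stalkIdeal (J.comap τ) x' ⊔ Ideal.span {χ (MvPolynomial.aeval (blowupAlgebra.frac c j) Φ)} := by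
    rw [stalkIdeal_sup, hSt, sup_comm]
  have e₂ : ((X'.presheaf.stalk x' ⧸ stalkIdeal (J.comap τ) x') ⧸
      Ideal.span {Ideal.Quotient.mk (stalkIdeal (J.comap τ) x') (χ (MvPolynomial.aeval (blowupAlgebra.frac c j) Φ))}) ≃+*
      (X'.presheaf.stalk x' ⧸ stalkIdeal (strictTransformIdeal τ J K ⊔ J.comap τ) x') := by
    refine (Ideal.quotEquivOfEq ?_).trans ((DoubleQuot.quotQuotEquivQuotSup _ _).trans (Ideal.quotEquivOfEq hCE.symm))
    rw [Ideal.map_span, Set.image_singleton]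
  rw [← ringKrullDim_eq_of_ringEquiv e₂, ← h1, ← h2, add_assoc, one_add_one_eq_two]

end Codim

/-! ## The uncentred member -/

section Uncentred

/-- **THE CONE GERM OF THE UNCENTRED MEMBER OF `inv_base` (HΔTC with the cone ideal free, any `n`).** In the binders of
res-L1-w45b-lead-1 / res-type-100's `exists_carrierDelta_of_admTC`: the carrier `E = (ker s)·𝒪_{X₁}` is a regular scheme with principal
stalks, and there is a non-zero germ `f ∈ 𝒪_{X',j x}` such that for EVERY ideal sheaf `K₀` on `X'` with `K₀_{j x} = (f)` the pair
`(E, St_{τ₁} K₀)` has: (i) exact special fibre `𝓘(Z)`, (ii) flatness over `O`, (iii′) principal cone stalks at the special points of the pair,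
(iv) support inside `E`, (v) regular quotient stalks at every point of the pair, of codimension `2` over the vertex, and a regular `V(E ⊔ St K₀)`.
[cite: Matsumura1987, Thm. 14.2; StacksProject, Tag 0804] -/
theorem exists_coneGerm_of_admTC (k : Type) [Field k] [IsAlgClosed k] (n : ℕ) :
    ∀ (O : Type) [CommRing O] [IsDomain O] [IsDiscreteValuationRing O] [IsAdicComplete (IsLocalRing.maximalIdeal O) O]
    [IsAlgClosed (IsLocalRing.ResidueField O)] (θ : O →+* k), Function.Surjective θ →
    ∀ (X' : AlgebraicGeometry.Scheme.{0}) (r' : X' ⟶ AlgebraicGeometry.Spec (.of O)) [AlgebraicGeometry.IsIntegral X']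
    [IsLocallyNoetherian X'], Literature.AlgebraicGeometry.Resolution.Scheme.IsRegular X' → AlgebraicGeometry.IsProper r' →
    ∀ (U : X'.Opens), AlgebraicGeometry.Smooth (U.ι ≫ r') →
    ∀ (s : AlgebraicGeometry.Spec (.of O) ⟶ X'), s ≫ r' = 𝟙 _ → s (IsLocalRing.closedPoint O) ∈ U →
    ringKrullDim (X'.presheaf.stalk (s (IsLocalRing.closedPoint O))) = ((n + 1 : ℕ) : WithBot ℕ∞) →
    ∀ (X₁ : AlgebraicGeometry.Scheme.{0}) (τ₁ : X₁ ⟶ X'), Literature.AlgebraicGeometry.Resolution.IsBlowup τ₁ s.ker →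
    ∀ (F₁ : AlgebraicGeometry.Scheme.{0}) [AlgebraicGeometry.IsIntegral F₁] (j : F₁ ⟶ X')
    (t : F₁ ⟶ AlgebraicGeometry.Spec (.of k)),
    IsPullback j t r' (AlgebraicGeometry.Spec.map (CommRingCat.ofHom θ)) →
    ∀ (x : F₁) (hx : IsClosed ({x} : Set F₁)), s (IsLocalRing.closedPoint O) = j x →
    ∀ (F₂ : AlgebraicGeometry.Scheme.{0}) [AlgebraicGeometry.IsIntegral F₂] (υ : F₂ ⟶ F₁),
    Literature.AlgebraicGeometry.Resolution.IsBlowup υ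
    (AlgebraicGeometry.Scheme.IdealSheafData.vanishingIdeal (⟨{x}, hx⟩ : TopologicalSpace.Closeds F₁)) →
    ∀ (j₂ : F₂ ⟶ X₁) (t₂ : F₂ ⟶ AlgebraicGeometry.Spec (.of k)),
    IsPullback j₂ t₂ (τ₁ ≫ r') (AlgebraicGeometry.Spec.map (CommRingCat.ofHom θ)) → j₂ ≫ τ₁ = υ ≫ j →
    (s.ker.comap τ₁).comap j₂ =
    (AlgebraicGeometry.Scheme.IdealSheafData.vanishingIdeal (⟨{x}, hx⟩ : TopologicalSpace.Closeds F₁)).comap υ →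
    ∀ (W : Set F₁) (hZ : IsClosed (υ ⁻¹' {x} ∩ closure (υ ⁻¹' (W \ {x})))), x ∈ W →
    ¬ (υ ⁻¹' {x} ⊆ closure (υ ⁻¹' (W \ {x}))) →
    (∃ U₁ : F₁.affineOpens, x ∈ (U₁ : F₁.Opens) ∧
    ((AlgebraicGeometry.Scheme.IdealSheafData.vanishingIdeal
    (⟨closure W, isClosed_closure⟩ : TopologicalSpace.Closeds F₁)).ideal U₁).IsPrincipal) →
    -- finitely many non-regular points of the reduced trace — OR the plane case `n = 3`, where this is automatic
    (n = 3 ∨ Set.Finite {z : ↥(AlgebraicGeometry.Scheme.IdealSheafData.vanishingIdeal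
    (⟨υ ⁻¹' {x} ∩ closure (υ ⁻¹' (W \ {x})), hZ⟩ : TopologicalSpace.Closeds F₂)).subscheme |
    ¬ IsRegularLocalRing ((AlgebraicGeometry.Scheme.IdealSheafData.vanishingIdeal
    (⟨υ ⁻¹' {x} ∩ closure (υ ⁻¹' (W \ {x})), hZ⟩ : TopologicalSpace.Closeds F₂)).subscheme.presheaf.stalk z)}) →
    Literature.AlgebraicGeometry.Resolution.Scheme.IsRegular (s.ker.comap τ₁).subscheme ∧
    (∀ z : X₁, (stalkIdeal (s.ker.comap τ₁) z).IsPrincipal) ∧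
    ∃ f : X'.presheaf.stalk (j x), f ≠ 0 ∧ ∀ (K₀ : X'.IdealSheafData), stalkIdeal K₀ (j x) = Ideal.span {f} →
    -- (i) exact special fibre
    (s.ker.comap τ₁ ⊔ strictTransformIdeal τ₁ s.ker K₀).comap j₂ = AlgebraicGeometry.Scheme.IdealSheafData.vanishingIdeal
      (⟨υ ⁻¹' {x} ∩ closure (υ ⁻¹' (W \ {x})), hZ⟩ : TopologicalSpace.Closeds F₂) ∧
    -- (ii) flat over `O`
    AlgebraicGeometry.Flat ((s.ker.comap τ₁ ⊔ strictTransformIdeal τ₁ s.ker K₀).subschemeι ≫ τ₁ ≫ r') ∧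
    -- (iii′) the cone is principal at the special points of the pair
    (∀ z ∈ ((s.ker.comap τ₁ ⊔ strictTransformIdeal τ₁ s.ker K₀).support : Set X₁), (τ₁ ≫ r') z = IsLocalRing.closedPoint O →
      (stalkIdeal (strictTransformIdeal τ₁ s.ker K₀) z).IsPrincipal) ∧
    -- (iv) inside the carrier
    ((s.ker.comap τ₁ ⊔ strictTransformIdeal τ₁ s.ker K₀).support : Set X₁) ⊆ ((s.ker.comap τ₁).support : Set X₁) ∧
    -- (v) regular quotient stalks at every point of the pair, of codimension `2` over the closed point; the pair is regular
    (∀ z ∈ ((s.ker.comap τ₁ ⊔ strictTransformIdeal τ₁ s.ker K₀).support : Set X₁),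
      IsRegularLocalRing (X₁.presheaf.stalk z ⧸ stalkIdeal (s.ker.comap τ₁ ⊔ strictTransformIdeal τ₁ s.ker K₀) z)) ∧
    (∀ z ∈ ((s.ker.comap τ₁ ⊔ strictTransformIdeal τ₁ s.ker K₀).support : Set X₁), (τ₁ ≫ r') z = IsLocalRing.closedPoint O →
      ringKrullDim (X₁.presheaf.stalk z ⧸ stalkIdeal (s.ker.comap τ₁ ⊔ strictTransformIdeal τ₁ s.ker K₀) z) + 2 =
        ringKrullDim (X₁.presheaf.stalk z)) ∧
    Literature.AlgebraicGeometry.Resolution.Scheme.IsRegular (s.ker.comap τ₁ ⊔ strictTransformIdeal τ₁ s.ker K₀).subscheme := by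
  intro O _ _ _ _ _ θ hθ X' r' _ _ hregX hproper U hU s hs hsU hdim4 X₁ τ₁ hτ₁ F₁ _ j t hsq x hx hss F₂ _ υ hυ j₂ t₂ hsq₂
    hcomm hE W hZ hxW hnot hU₁ hfin
  classical
  -- adapted from res-L1-w45b-lead-1's `exists_carrierDelta_of_admTC` (…NatCarrierDeltaHDeltaTC): (S1)–(S5) verbatim, pair kept
  haveI := hproper
  haveI : IsClosedImmersion (Spec.map (CommRingCat.ofHom θ)) := IsClosedImmersion.spec_of_surjective _ hθ
  haveI : IsClosedImmersion j := MorphismProperty.IsStableUnderBaseChange.of_isPullback hsq.flip inferInstance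
  haveI : IsLocallyNoetherian X₁ := by
    haveI : IsProper τ₁ := hτ₁.isProper
    exact LocallyOfFiniteType.isLocallyNoetherian τ₁
  haveI : IsLocallyNoetherian F₁ := LocallyOfFiniteType.isLocallyNoetherian j
  haveI : IsLocallyNoetherian F₂ := by
    haveI : IsProper υ := hυ.isProper
    exact LocallyOfFiniteType.isLocallyNoetherian υ
  obtain ⟨ϖ, hϖ⟩ := IsDiscreteValuationRing.exists_irreducible O
  have hϖO : ϖ ∈ maximalIdeal O := by rw [hϖ.maximalIdeal_eq]; exact Ideal.mem_span_singleton_self ϖ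
  -- (S1) the frame at `p = j x`; the T-DIM antecedent matches the frame length `n'` with `n`
  rw [hss] at hdim4
  obtain ⟨n', c, θR, hcI, hqr, hdom, hθR, h𝔪, hϖc, hdimn⟩ :=
    exists_sectionFrame_forall_dim_at O r' s hs (j x) hss (hregX (j x)) ϖ hϖ
  have hn : n' + 1 = n + 1 := by
    have h := hdimn.symm.trans hdim4
    exact_mod_cast h
  obtain rfl : n = n' := by omega
  haveI := hdom
  -- the model frame downstairs
  have hcb𝔪 := span_stalkMap_eq_maximalIdeal_of_model θ hθ r' j t hsq x ϖ hϖO c h𝔪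
  have hcbar := isQuasiRegular_stalkMap_model O k θ hθ r' j t hsq x c hqr ϖ hϖ hϖc
  haveI hFreg : IsRegularLocalRing (F₁.presheaf.stalk x) :=
    isRegularLocalRing_stalk_of_model O k θ hθ r' j t hsq x (hregX (j x)) ϖ hϖ c h𝔪 hϖc
  have hJ : s.ker.comap j = vanishingIdeal ⟨{x}, hx⟩ :=
    comap_ker_eq_vanishingIdeal_of_model θ hθ r' s hs j t hsq x hx hss c hcI hcb𝔪
  haveI hmax : (Ideal.span (Set.range fun i => (j.stalkMap x).hom (c i))).IsMaximal := by
    rw [hcb𝔪]; exact maximalIdeal.isMaximal _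
  -- (S2) T-TCONE downstairs: the initial form `Φ₁` of `closure W` at `c̄` and its square-free reduction `G`
  obtain ⟨U₁, hxU₁, hpr⟩ := hU₁
  obtain ⟨d, Φ₁, -, hΦ₁d, hΦ₁0, hW⟩ :=
    exists_isHomogeneous_of_isPrincipal hx hυ (fun i => (j.stalkMap x).hom (c i)) hcb𝔪 W hxW U₁ hxU₁ hpr hnot
  obtain ⟨d', G, hGd', hG0, -, hR1, hR1', hR2, hR2sq⟩ :=
    exists_isHomogeneous_squarefree_reduction (fun i => (j.stalkMap x).hom (c i)) hmax Φ₁ hΦ₁d hΦ₁0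
  -- (S3) the residue model `π₀ : O ↠ k₀ = 𝒪_{F₁,x}/(c̄)` and T-ΔLIFT over `k₀`
  letI : Field (F₁.presheaf.stalk x ⧸ Ideal.span (Set.range fun i => (j.stalkMap x).hom (c i))) :=
    Ideal.Quotient.field _
  obtain ⟨π₀, hπ₀def⟩ : ∃ π₀ : O →+* F₁.presheaf.stalk x ⧸ Ideal.span (Set.range fun i => (j.stalkMap x).hom (c i)),
      π₀ = ((Ideal.Quotient.mk (Ideal.span (Set.range fun i => (j.stalkMap x).hom (c i)))).comp
        (j.stalkMap x).hom).comp ((Scheme.ΓSpecIso (.of O)).inv ≫ r'.appTop ≫ X'.presheaf.Γgerm (j x)).hom :=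
    ⟨_, rfl⟩
  obtain ⟨hπ₀, hkerπ₀⟩ := residueModel_surjective_and_ker θ hθ r' j t hsq x c θR hθR hcb𝔪 hπ₀def
  haveI : Infinite (F₁.presheaf.stalk x ⧸ Ideal.span (Set.range fun i => (j.stalkMap x).hom (c i))) := by
    haveI : Infinite (ResidueField O) := inferInstance
    exact Infinite.of_injective (β := ResidueField O)
      ((Ideal.quotEquivOfEq hkerπ₀.symm).trans (RingHom.quotientKerEquivOfSurjective hπ₀))
      ((Ideal.quotEquivOfEq hkerπ₀.symm).trans (RingHom.quotientKerEquivOfSurjective hπ₀)).injective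
  have hρ₀ : (θR.toRingHom.comp (Ideal.Quotient.mk (Ideal.span (Set.range c)))).comp
      ((Scheme.ΓSpecIso (.of O)).inv ≫ r'.appTop ≫ X'.presheaf.Γgerm (j x)).hom = RingHom.id O :=
    RingHom.ext fun b => hθR b
  -- (S3′) the finiteness clause transported to the cone charts (res-L1-w45b-stub-2 T-PTPRIME-DICT)
  have hZ' : IsClosed (υ ⁻¹' {x} ∩ closure (υ ⁻¹' (((⟨closure W, isClosed_closure⟩ : Closeds F₁) : Set F₁) \ {x}))) := by
    rw [Closeds.coe_mk, ← closure_preimage_diff_singleton_eq_of_isBlowup hx hυ W]; exact hZ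
  have hcl : (⟨υ ⁻¹' {x} ∩ closure (υ ⁻¹' (W \ {x})), hZ⟩ : Closeds F₂) =
      ⟨υ ⁻¹' {x} ∩ closure (υ ⁻¹' (((⟨closure W, isClosed_closure⟩ : Closeds F₁) : Set F₁) \ {x})), hZ'⟩ :=
    Closeds.ext (by rw [Closeds.coe_mk, Closeds.coe_mk, Closeds.coe_mk, closure_preimage_diff_singleton_eq_of_isBlowup hx hυ W])
  -- T-ΔLIFT: res-type-032's PLANE lemma at `n = 3` (finiteness from square-freeness), else the general one fed by stub-2's
  -- T-PTPRIME-DICT transport of the finiteness clause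
  obtain ⟨Φ₀, hΦ₀d, hΦ₀g, h032⟩ : ∃ Φ₀ : MvPolynomial (Fin n) O, Φ₀.IsHomogeneous d' ∧ MvPolynomial.map π₀ Φ₀ =
      MvPolynomial.map (Ideal.Quotient.mk (Ideal.span (Set.range fun i => (j.stalkMap x).hom (c i)))) G ∧
      ∀ (i : Fin n) (Q : Ideal (MvPolynomial {l : Fin n // l ≠ i} O ⧸ Ideal.span {MvPolynomial.map
        (θR.toRingHom.comp (Ideal.Quotient.mk (Ideal.span (Set.range c))))
        (dehomogenize i (MvPolynomial.map ((Scheme.ΓSpecIso (.of O)).inv ≫ r'.appTop ≫ X'.presheaf.Γgerm (j x)).hom Φ₀))}))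
        [Q.IsPrime], Ideal.Quotient.mk _ (MvPolynomial.C ϖ : MvPolynomial {l : Fin n // l ≠ i} O) ∈ Q →
          IsRegularLocalRing (Localization.AtPrime Q) := by
    rcases hfin with hn3 | hfin
    · subst hn3
      have hgsq : ∀ i : Fin 3, Squarefree (dehomogenize i
          (MvPolynomial.map (Ideal.Quotient.mk (Ideal.span (Set.range fun i => (j.stalkMap x).hom (c i)))) G)) := fun i => by
        have h := hR2sq i
        rwa [map_dehomogenize] at h
      exact exists_isHomogeneous_lift_deltaRegular_plane_comp hϖ π₀ hπ₀ hkerπ₀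
        ((Scheme.ΓSpecIso (.of O)).inv ≫ r'.appTop ≫ X'.presheaf.Γgerm (j x)).hom
        (θR.toRingHom.comp (Ideal.Quotient.mk (Ideal.span (Set.range c)))) hρ₀
        (MvPolynomial.map (Ideal.Quotient.mk (Ideal.span (Set.range fun i => (j.stalkMap x).hom (c i)))) G)
        (hGd'.map _) hG0 hgsq
    · have hfin' := hfin
      rw [hcl] at hfin'
      have hfin032 : ∀ i : Fin n, {𝔮 : PrimeSpectrum (MvPolynomial {l : Fin n // l ≠ i}
          (F₁.presheaf.stalk x ⧸ Ideal.span (Set.range fun i => (j.stalkMap x).hom (c i)))) |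
          dehomogenize i (MvPolynomial.map (Ideal.Quotient.mk (Ideal.span (Set.range fun i => (j.stalkMap x).hom (c i)))) G) ∈
            𝔮.asIdeal ∧
          algebraMap _ (Localization.AtPrime 𝔮.asIdeal)
            (dehomogenize i (MvPolynomial.map (Ideal.Quotient.mk (Ideal.span (Set.range fun i => (j.stalkMap x).hom (c i)))) G)) ∈
            maximalIdeal (Localization.AtPrime 𝔮.asIdeal) ^ 2}.Finite := by
        intro i
        have hGj : MvPolynomial.map (Ideal.Quotient.mk (Ideal.span (Set.range fun i => (j.stalkMap x).hom (c i))))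
            (dehomogenize i G) ≠ 0 := fun h => by
          have hsq := hR2sq i
          rw [h] at hsq
          exact not_squarefree_zero hsq
        have h := finite_badPrimes_of_finite_nonregular_carrierTrace hx hυ (fun i => (j.stalkMap x).hom (c i)) hcb𝔪 hcbar
          (Ideal.Quotient.mk (Ideal.span (Set.range fun i => (j.stalkMap x).hom (c i)))) Ideal.Quotient.mk_surjective Ideal.mk_ker
          ⟨closure W, isClosed_closure⟩ Φ₁ G hΦ₁d hΦ₁0 hW hR1 hR1' hR2 hZ' hfin' i hGj
        rw [map_dehomogenize] at h
        exact h
      exact exists_isHomogeneous_lift_deltaRegular_comp hϖ π₀ hπ₀ hkerπ₀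
        ((Scheme.ΓSpecIso (.of O)).inv ≫ r'.appTop ≫ X'.presheaf.Γgerm (j x)).hom
        (θR.toRingHom.comp (Ideal.Quotient.mk (Ideal.span (Set.range c)))) hρ₀
        (MvPolynomial.map (Ideal.Quotient.mk (Ideal.span (Set.range fun i => (j.stalkMap x).hom (c i)))) G)
        (hGd'.map _) hfin032
  -- consequences: `Φ₀ ≢ 0 mod 𝔪_O`, `ι_* Φ₀ ≢ 0 mod (c)`, `j^♯ ι_* Φ₀ ≡ g mod (c̄)`
  have hΦ₀res : MvPolynomial.map (IsLocalRing.residue O) Φ₀ ≠ 0 := fun h => hG0 (by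
    rw [← hΦ₀g]
    refine map_eq_zero_of_coeff_mem_ker π₀ fun m => ?_
    rw [hkerπ₀, ← IsLocalRing.ker_residue]
    exact coeff_mem_ker_of_map_eq_zero (IsLocalRing.residue O) h m)
  have hΦ₀ne : Φ₀ ≠ 0 := fun h0 => hG0 (by rw [← hΦ₀g, h0, map_zero])
  have hΦι : MvPolynomial.map (Ideal.Quotient.mk (Ideal.span (Set.range c)))
      (MvPolynomial.map ((Scheme.ΓSpecIso (.of O)).inv ≫ r'.appTop ≫ X'.presheaf.Γgerm (j x)).hom Φ₀) ≠ 0 := by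
    intro h
    apply hΦ₀ne
    have h2 := congrArg (MvPolynomial.map θR.toRingHom) h
    rwa [MvPolynomial.map_map, MvPolynomial.map_map, hρ₀, MvPolynomial.map_id, map_zero] at h2
  have hΦbg : MvPolynomial.map (Ideal.Quotient.mk (Ideal.span (Set.range fun i => (j.stalkMap x).hom (c i))))
      (MvPolynomial.map (j.stalkMap x).hom
        (MvPolynomial.map ((Scheme.ΓSpecIso (.of O)).inv ≫ r'.appTop ≫ X'.presheaf.Γgerm (j x)).hom Φ₀)) =
      MvPolynomial.map (Ideal.Quotient.mk (Ideal.span (Set.range fun i => (j.stalkMap x).hom (c i)))) G := by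
    rw [MvPolynomial.map_map, MvPolynomial.map_map, ← hπ₀def, hΦ₀g]
  have hΦbar : MvPolynomial.map (Ideal.Quotient.mk (Ideal.span (Set.range fun i => (j.stalkMap x).hom (c i))))
      (MvPolynomial.map (j.stalkMap x).hom
        (MvPolynomial.map ((Scheme.ΓSpecIso (.of O)).inv ≫ r'.appTop ≫ X'.presheaf.Γgerm (j x)).hom Φ₀)) ≠ 0 := by
    rw [hΦbg]; exact hG0
  -- the Δ-criterion in the kit's `ρ`-form
  have hΔ : ∀ (ρ : X'.presheaf.stalk (j x) →+* O),
      ρ.comp ((Scheme.ΓSpecIso (.of O)).inv ≫ r'.appTop ≫ X'.presheaf.Γgerm (j x)).hom = RingHom.id O →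
      ∀ (i : Fin n) (Q : Ideal (MvPolynomial {l : Fin n // l ≠ i} O ⧸ Ideal.span {MvPolynomial.map ρ
        (dehomogenize i (MvPolynomial.map ((Scheme.ΓSpecIso (.of O)).inv ≫ r'.appTop ≫ X'.presheaf.Γgerm (j x)).hom Φ₀))}))
        [Q.IsPrime], Ideal.Quotient.mk _ (MvPolynomial.C ϖ : MvPolynomial {l : Fin n // l ≠ i} O) ∈ Q →
          IsRegularLocalRing (Localization.AtPrime Q) :=
    fun ρ hρ i => forall_ideal_quotient_span_singleton_congr
      ((map_dehomogenize_map_of_comp_eq_id _ ρ hρ i Φ₀).trans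
        (map_dehomogenize_map_of_comp_eq_id _ _ hρ₀ i Φ₀).symm) (MvPolynomial.C ϖ) (h032 i)
  have hΦιd : (MvPolynomial.map ((Scheme.ΓSpecIso (.of O)).inv ≫ r'.appTop ≫ X'.presheaf.Γgerm (j x)).hom Φ₀).IsHomogeneous d' :=
    hΦ₀d.map _
  have hpJ : j x ∈ (s.ker.support : Set X') := by
    obtain ⟨-, -, -, hsupp⟩ := section_isClosedImmersion_and_isRegular_ker O X' r' s hs
    rw [hsupp, ← hss]; exact Set.mem_range_self _
  haveI : IsRegularRing (X'.presheaf.stalk (j x) ⧸ Ideal.span (Set.range c)) := IsRegularRing.of_ringEquiv θR.symm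
  refine ⟨isRegular_exceptional_subscheme O r' s hs (j x) hss τ₁ hτ₁ c hcI hqr θR, fun z => ?_,
    MvPolynomial.eval c (MvPolynomial.map ((Scheme.ΓSpecIso (.of O)).inv ≫ r'.appTop ≫ X'.presheaf.Γgerm (j x)).hom Φ₀),
    eval_ne_zero_of_isQuasiRegular hqr hΦιd hΦι, fun K₀ hK => ?_⟩
  · -- `E` is locally principal (an effective Cartier divisor)
    obtain ⟨g, -, hg⟩ := hτ₁.isEffectiveCartier.exists_stalkIdeal_eq_span z
    exact ⟨⟨g, hg⟩⟩
  -- (S4) T-CARRIER-Δ for the arbitrary cone ideal `K₀` (part 1a); rewrite `E ⊔ St K₀ = St K₀ ⊔ E` once and for all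
  obtain ⟨hCreg, hCflat, hCsupp⟩ := carrierDelta_clauses_of_stalk O r' s hs (j x) hss (hregX (j x)) τ₁ hτ₁ ϖ hϖ c hcI hdim4
    Φ₀ hΦ₀d hΦ₀res hΔ K₀ hK
  rw [show s.ker.comap τ₁ ⊔ strictTransformIdeal τ₁ s.ker K₀ = strictTransformIdeal τ₁ s.ker K₀ ⊔ s.ker.comap τ₁ from sup_comm _ _]
  refine ⟨?_, hCflat, ?_, hCsupp, fun z hz => isRegularLocalRing_quotient_stalkIdeal_of_isRegular_subscheme _ hCreg hz, ?_, hCreg⟩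
  · -- (i) = (S5): the special fibre, (v) then T-TCONE (2) for `closure W`, then `closure W ↦ W` (verbatim from HΔTC)
    rw [comap_strictTransformIdeal_sup_comap_eq_of_model τ₁ s.ker _ hτ₁ j υ j₂ hcomm x hx hυ hJ c hcI hqr _ hΦιd hΦι hK
      hcbar hΦbar]
    have hK' : stalkIdeal (K₀.comap j) x =
        Ideal.span {MvPolynomial.eval (fun i => (j.stalkMap x).hom (c i)) (MvPolynomial.map (j.stalkMap x).hom
          (MvPolynomial.map ((Scheme.ΓSpecIso (.of O)).inv ≫ r'.appTop ≫ X'.presheaf.Γgerm (j x)).hom Φ₀))} := by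
      rw [stalkIdeal_comap_eq_map_stalkMap, hK, Ideal.map_span, Set.image_singleton, ringHom_eval_eq_eval_map]
    rw [hcl]
    exact (vanishingIdeal_carrierTrace_eq_strictTransformIdeal_sup_comap hx hυ (fun i => (j.stalkMap x).hom (c i)) hcb𝔪 hcbar
      ⟨closure W, isClosed_closure⟩ _ Φ₁ _ hΦ₁d (hΦιd.map _) hΦ₁0 hΦbar hW hK' (by rw [hΦbg]; exact hR1)
      (by rw [hΦbg]; exact hR1') (fun i => by rw [map_dehomogenize, hΦbg, ← map_dehomogenize]; exact hR2 i) hZ').symm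
  · -- (iii′) the cone is principal at the special points of the pair (all over `p = j x`)
    intro z hz hzq
    have hzp : τ₁ z = j x := by
      rw [← hss]
      exact support_carrierDelta_inter_preimage_closedPoint_subset O r' s hs τ₁ _ ⟨hz, hzq⟩
    exact isPrincipal_stalkIdeal_strictTransformIdeal_of_cone hτ₁ _ z (j x) hzp hpJ c hcI hqr _ hΦιd hΦι hK
  · -- (v) codimension `2` at the special points of the pair
    intro z hz hzq
    have hzp : τ₁ z = j x := by
      rw [← hss]
      exact support_carrierDelta_inter_preimage_closedPoint_subset O r' s hs τ₁ _ ⟨hz, hzq⟩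
    exact ringKrullDim_quotient_carrierDelta_add_two hτ₁ _ z (j x) hzp hpJ c hcI hqr _ hΦιd hΦι hK hz

end Uncentred

end Summit.ResolutionOfSingularities.ResolutionOfSingularities.Cruxes.EquisingularLiftNat.Sections

end
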